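import Mathlib.RingTheory.RootsOfUnity.Complex
import Mathlib.RingTheory.Polynomial.Cyclotomic.Basic
import Mathlib.RingTheory.IntegralClosure.IsIntegralClosure.Basic
import Mathlib.Data.ZMod.Basic
import HarnessLib

/-!
# F″ programme, piece P4-tail bricks: `p′`-integrality (`∃ s ∈ ℕ, p ∤ s, s·a ∈ ℤ̄`) is preserved under
# multiplication by algebraic integers and under DIVISION by `p′`-units of `ℤ̄`; the cyclotomic `p′`-unit
# `(c − ζ)·t′ = 1 + c + ⋯ + c^{n−1} ∈ ℤ ∖ pℤ` (Kato's factor `T_{c,d}(χ) = (c² − cχ(c))(d² − dχ̄(d))`)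

Cell `pub/bsd-wall`, seat `bsd-wall-manin-p1` g8 (explicit-unit; crux of record stmt-BirchSwinnertonDyer-20709
`ManinFrameResidueProperR` ⟸ F″ = `Literature.NumberTheory.EllipticCurves.kato_neron_isIntegral_twistedSymbolSum_of_additive_five_le`,
p596221); `--supports stmt-BirchSwinnertonDyer-20709` (helper). TOOL theorems only (no definition, no named fact,
no `sorry`); nothing about any curve; BSD / 20709 / 22226 are not proved by any of this.

WHY. In the F″ programme (`Cruxes/StarredOptimalManinUnitFiveSeven/Lines/kato-lever-F2-programme.md` §4) the
chain F″ ⟸ P1 reads: P1's value law `Σ_b χ̄(b)σ_b(x) = T·u·n_ξ·L_{pN}(f, χ̄, 1)/Ω^±(V)` (Kato Thm. 6.6 (1), case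
`ξ ∈ SL₂(ℤ)`, `T = (c² − cχ̄(c))(d² − dχ(d))`, `u·n_ξ ∈ {±2^j}`) → receptacle (P2/P3) → semi-local descent
(`…Theorems.SemiLocalDescent.exists_not_dvd_isIntegral_charSum_of_forall_semilocal_mem`, p598912: the character sum is
`p′`-integral) → **divide the `p′`-units `T`, `u·n_ξ`** (THIS FILE) → value exit
(`…Theorems.StarredOptimalManinUnitFiveSevenValueExit.katoNeron_{even,odd}_of_depletedValue`) → F″. The currency
throughout is the bare predicate shape `∃ s : ℕ, ¬ p ∣ s ∧ IsIntegral ℤ ((s : A) * a)` of F″'s conclusion (no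
definition is introduced).

CONTENTS.
* §1 closure rules in any commutative ring `A` (resp. a field of characteristic `0` for rational scalars):
  `…_of_isIntegral`, `…_mul_of_isIntegral_right/left`, `…_mul`, `…_add`, `…_neg`,
  ★ `exists_not_dvd_isIntegral_of_mul_of_mul_eq_natCast` (division by `t ∈ ℤ̄` with `t·t′ = k ∈ ℕ`, `p ∤ k`,
  `t′ ∈ ℤ̄`), `…_of_mul_eq_intCast`, `…_of_natCast_mul`, `…_of_intCast_mul`, `…_of_ratCast_mul`
  (`q ∈ ℚ` with numerator prime to `p`, e.g. `u·n_ξ = ±2^j`, `p` odd).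
* §2 the cyclotomic unit: `prod_X_sub_C_erase_one_eq_geom_sum` (`∏_{μⁿ=1, μ≠1}(X − μ) = Σ_{i<n} X^i` over a domain
  with a primitive `n`-th root of unity), `exists_isIntegral_sub_mul_eq_geom_sum` (`(c − ζ)·t′ = Σ_{i<n} c^i`,
  `t′ ∈ ℤ̄`), `not_dvd_geom_sum_of_modEq_one` (`c ≡ 1 (p)`, `p ∤ n` ⟹ `p ∤ Σ_{i<n} c^i`),
  ★ `exists_not_dvd_isIntegral_of_sub_rootOfUnity_mul` (divide by `c − ζ`), ★★
  `exists_not_dvd_isIntegral_of_katoFactor_mul` (divide by `c² − c·ζ = c(c − ζ)`, `c ≡ 1 (p)`).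

References: folklore (Dedekind/Kummer: `∏_{0<k<n}(1 − ζ^k) = n`); K. Kato, Astérisque 295 (2004), Thm. 6.6 (1)
p. 163 (the factor `(c² − c^uχ(c))(d² − d^vχ̄(d))`, case `ξ ∈ SL₂(ℤ)`) [Kato2004Asterisque] — context only, nothing
of Kato is used or restated here.
-/

set_option autoImplicit false
-- the Theorems namespace of a single-conjunct summit repeats the summit name by design (D-0017)
set_option linter.dupNamespace false

noncomputable section

open scoped BigOperators
open Polynomial Finset

namespace Summit.BirchSwinnertonDyer.BirchSwinnertonDyer.Theorems.PIntegralUnits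

/-! ## §1 Closure rules for `∃ s : ℕ, ¬ p ∣ s ∧ IsIntegral ℤ (s · a)` -/

section Closure

variable {A : Type*} [CommRing A] (p : ℕ)

/-- An algebraic integer is `p′`-integral (`s = 1`). [folklore] -/
theorem exists_not_dvd_isIntegral_of_isIntegral (hp : p ≠ 1) {a : A} (ha : IsIntegral ℤ a) :
    ∃ s : ℕ, ¬ p ∣ s ∧ IsIntegral ℤ ((s : A) * a) :=
  ⟨1, fun h => hp (Nat.dvd_one.mp h), by rw [Nat.cast_one, one_mul]; exact ha⟩

/-- `p′`-integral × algebraic integer is `p′`-integral. [folklore] -/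
theorem exists_not_dvd_isIntegral_mul_of_isIntegral_right {a b : A}
    (ha : ∃ s : ℕ, ¬ p ∣ s ∧ IsIntegral ℤ ((s : A) * a)) (hb : IsIntegral ℤ b) :
    ∃ s : ℕ, ¬ p ∣ s ∧ IsIntegral ℤ ((s : A) * (a * b)) := by
  obtain ⟨s, hs, hsa⟩ := ha
  exact ⟨s, hs, by rw [← mul_assoc]; exact hsa.mul hb⟩

/-- Algebraic integer × `p′`-integral is `p′`-integral. [folklore] -/
theorem exists_not_dvd_isIntegral_mul_of_isIntegral_left {a b : A}
    (ha : IsIntegral ℤ a) (hb : ∃ s : ℕ, ¬ p ∣ s ∧ IsIntegral ℤ ((s : A) * b)) :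
    ∃ s : ℕ, ¬ p ∣ s ∧ IsIntegral ℤ ((s : A) * (a * b)) := by
  obtain ⟨s, hs, hsb⟩ := hb
  exact ⟨s, hs, by rw [mul_left_comm]; exact ha.mul hsb⟩

/-- A product of two `p′`-integral elements is `p′`-integral (`p` prime). [folklore] -/
theorem exists_not_dvd_isIntegral_mul (hp : p.Prime) {a b : A}
    (ha : ∃ s : ℕ, ¬ p ∣ s ∧ IsIntegral ℤ ((s : A) * a))
    (hb : ∃ s : ℕ, ¬ p ∣ s ∧ IsIntegral ℤ ((s : A) * b)) :
    ∃ s : ℕ, ¬ p ∣ s ∧ IsIntegral ℤ ((s : A) * (a * b)) := by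
  obtain ⟨s, hs, hsa⟩ := ha
  obtain ⟨t, ht, htb⟩ := hb
  refine ⟨s * t, fun h => (hp.dvd_mul.mp h).elim hs ht, ?_⟩
  have : ((s * t : ℕ) : A) * (a * b) = ((s : A) * a) * ((t : A) * b) := by push_cast; ring
  rw [this]
  exact hsa.mul htb

/-- A sum of two `p′`-integral elements is `p′`-integral (`p` prime). [folklore] -/
theorem exists_not_dvd_isIntegral_add (hp : p.Prime) {a b : A}
    (ha : ∃ s : ℕ, ¬ p ∣ s ∧ IsIntegral ℤ ((s : A) * a))
    (hb : ∃ s : ℕ, ¬ p ∣ s ∧ IsIntegral ℤ ((s : A) * b)) :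
    ∃ s : ℕ, ¬ p ∣ s ∧ IsIntegral ℤ ((s : A) * (a + b)) := by
  obtain ⟨s, hs, hsa⟩ := ha
  obtain ⟨t, ht, htb⟩ := hb
  refine ⟨s * t, fun h => (hp.dvd_mul.mp h).elim hs ht, ?_⟩
  have hti : IsIntegral ℤ (t : A) := by
    simpa using isIntegral_algebraMap (R := ℤ) (A := A) (x := (t : ℤ))
  have hsi : IsIntegral ℤ (s : A) := by
    simpa using isIntegral_algebraMap (R := ℤ) (A := A) (x := (s : ℤ))
  have : ((s * t : ℕ) : A) * (a + b) = (t : A) * ((s : A) * a) + (s : A) * ((t : A) * b) := by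
    push_cast; ring
  rw [this]
  exact (hti.mul hsa).add (hsi.mul htb)

/-- `p′`-integrality is stable under negation. [folklore] -/
theorem exists_not_dvd_isIntegral_neg {a : A} (ha : ∃ s : ℕ, ¬ p ∣ s ∧ IsIntegral ℤ ((s : A) * a)) :
    ∃ s : ℕ, ¬ p ∣ s ∧ IsIntegral ℤ ((s : A) * (-a)) := by
  obtain ⟨s, hs, hsa⟩ := ha
  exact ⟨s, hs, by rw [mul_neg]; exact hsa.neg⟩

/-- ★ **Division by a `p′`-unit of `ℤ̄`.** If `t·a` is `p′`-integral and `t` divides, inside the algebraic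
integers, a natural number `k` prime to `p` (`t·t′ = k`, `t′ ∈ ℤ̄`), then `a` is `p′`-integral:
`(s·k)·a = (s·t·a)·t′`. [folklore] -/
theorem exists_not_dvd_isIntegral_of_mul_of_mul_eq_natCast (hp : p.Prime) {t t' a : A} {k : ℕ}
    (hta : ∃ s : ℕ, ¬ p ∣ s ∧ IsIntegral ℤ ((s : A) * (t * a))) (ht' : IsIntegral ℤ t')
    (htt' : t * t' = (k : A)) (hk : ¬ p ∣ k) :
    ∃ s : ℕ, ¬ p ∣ s ∧ IsIntegral ℤ ((s : A) * a) := by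
  obtain ⟨s, hs, hsa⟩ := hta
  refine ⟨s * k, fun h => (hp.dvd_mul.mp h).elim hs hk, ?_⟩
  have : ((s * k : ℕ) : A) * a = ((s : A) * (t * a)) * t' := by
    push_cast; rw [← htt']; ring
  rw [this]
  exact hsa.mul ht'

/-- Division by a `p′`-unit of `ℤ̄`, integer form (`t·t′ = k ∈ ℤ`, `p ∤ k`). [folklore] -/
theorem exists_not_dvd_isIntegral_of_mul_of_mul_eq_intCast (hp : p.Prime) {t t' a : A} {k : ℤ}
    (hta : ∃ s : ℕ, ¬ p ∣ s ∧ IsIntegral ℤ ((s : A) * (t * a))) (ht' : IsIntegral ℤ t')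
    (htt' : t * t' = (k : A)) (hk : ¬ (p : ℤ) ∣ k) :
    ∃ s : ℕ, ¬ p ∣ s ∧ IsIntegral ℤ ((s : A) * a) := by
  obtain ⟨m, hm⟩ : ∃ m : ℕ, k = m ∨ k = -m := ⟨k.natAbs, Int.natAbs_eq k⟩
  rcases hm with rfl | rfl
  · exact exists_not_dvd_isIntegral_of_mul_of_mul_eq_natCast p hp hta ht'
      (by rw [htt', Int.cast_natCast]) (fun h => hk (Int.natCast_dvd_natCast.mpr h))
  · refine exists_not_dvd_isIntegral_of_mul_of_mul_eq_natCast p hp hta ht'.neg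
      (by rw [mul_neg, htt', Int.cast_neg, Int.cast_natCast, neg_neg]) (fun h => hk ?_)
    exact (dvd_neg).mpr (Int.natCast_dvd_natCast.mpr h)

/-- Division by a natural number prime to `p`. [folklore] -/
theorem exists_not_dvd_isIntegral_of_natCast_mul (hp : p.Prime) {a : A} {k : ℕ}
    (hka : ∃ s : ℕ, ¬ p ∣ s ∧ IsIntegral ℤ ((s : A) * ((k : A) * a))) (hk : ¬ p ∣ k) :
    ∃ s : ℕ, ¬ p ∣ s ∧ IsIntegral ℤ ((s : A) * a) :=
  exists_not_dvd_isIntegral_of_mul_of_mul_eq_natCast p hp hka isIntegral_one (by rw [mul_one]) hk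

/-- Division by an integer prime to `p`. [folklore] -/
theorem exists_not_dvd_isIntegral_of_intCast_mul (hp : p.Prime) {a : A} {k : ℤ}
    (hka : ∃ s : ℕ, ¬ p ∣ s ∧ IsIntegral ℤ ((s : A) * ((k : A) * a))) (hk : ¬ (p : ℤ) ∣ k) :
    ∃ s : ℕ, ¬ p ∣ s ∧ IsIntegral ℤ ((s : A) * a) :=
  exists_not_dvd_isIntegral_of_mul_of_mul_eq_intCast p hp hka isIntegral_one (by rw [mul_one]) hk

end Closure

section RatScalar

variable {F : Type*} [Field F] [CharZero F] (p : ℕ)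

/-- Division by a rational number whose NUMERATOR is prime to `p` (e.g. Kato's `u·n_ξ ∈ {±2^j}` at odd `p`):
if `q·a` is `p′`-integral then so is `a` (`(s·|num q|)·a = ±den q · (s·q·a)`). [folklore] -/
theorem exists_not_dvd_isIntegral_of_ratCast_mul (hp : p.Prime) {a : F} {q : ℚ}
    (hqa : ∃ s : ℕ, ¬ p ∣ s ∧ IsIntegral ℤ ((s : F) * ((q : F) * a))) (hq : ¬ (p : ℤ) ∣ q.num) :
    ∃ s : ℕ, ¬ p ∣ s ∧ IsIntegral ℤ ((s : F) * a) := by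
  -- `num · a = den · (q · a)`, and `den ∈ ℤ̄`
  have hden : IsIntegral ℤ ((q.den : ℤ) : F) := by
    simpa using isIntegral_algebraMap (R := ℤ) (A := F) (x := (q.den : ℤ))
  have hnum : (q.num : F) * a = ((q.den : ℤ) : F) * ((q : F) * a) := by
    have hd : (q.den : F) ≠ 0 := by exact_mod_cast q.den_ne_zero
    rw [← mul_assoc, Int.cast_natCast]
    congr 1
    rw [Rat.cast_def, mul_div_cancel₀ _ hd]
  have hka : ∃ s : ℕ, ¬ p ∣ s ∧ IsIntegral ℤ ((s : F) * ((q.num : F) * a)) := by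
    rw [hnum]
    exact exists_not_dvd_isIntegral_mul_of_isIntegral_left p hden hqa
  exact exists_not_dvd_isIntegral_of_intCast_mul p hp hka hq

end RatScalar

/-! ## §2 The cyclotomic `p′`-unit `c − ζ` -/

section Cyclotomic

variable {K : Type*} [CommRing K] [IsDomain K]

/-- Over a domain with a primitive `n`-th root of unity: `∏_{μⁿ = 1, μ ≠ 1} (X − μ) = 1 + X + ⋯ + X^{n−1}`
(both sides times `X − 1` give `Xⁿ − 1`). [folklore] -/
theorem prod_X_sub_C_erase_one_eq_geom_sum [DecidableEq K] {n : ℕ} (hn : 0 < n) {ζ₀ : K}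
    (hζ₀ : IsPrimitiveRoot ζ₀ n) :
    ∏ μ ∈ (nthRootsFinset n (1 : K)).erase 1, (X - C μ) = ∑ i ∈ range n, (X : K[X]) ^ i := by
  have h1 : (1 : K) ∈ nthRootsFinset n (1 : K) := (mem_nthRootsFinset hn (1 : K)).mpr (one_pow n)
  have hprod := Finset.mul_prod_erase (nthRootsFinset n (1 : K)) (fun μ => (X - C μ)) h1
  have hXn : (X : K[X]) ^ n - 1 = ∏ μ ∈ nthRootsFinset n (1 : K), (X - C μ) := X_pow_sub_one_eq_prod hn hζ₀
  have hgeom := geom_sum_mul (X : K[X]) n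
  -- `(X - 1) · ∏' = Xⁿ − 1 = (Σ Xⁱ) · (X − 1)`
  have key : (X - C (1 : K)) * ∏ μ ∈ (nthRootsFinset n (1 : K)).erase 1, (X - C μ) =
      (X - C (1 : K)) * ∑ i ∈ range n, (X : K[X]) ^ i := by
    rw [hprod, ← hXn, ← hgeom, map_one, mul_comm]
  exact mul_left_cancel₀ (X_sub_C_ne_zero (1 : K)) key

/-- For an `n`-th root of unity `ζ ≠ 1` and an integer `c` (over a domain with a primitive `n`-th root of unity):
`(c − ζ)·t′ = Σ_{i<n} cⁱ` with `t′` an algebraic integer (the product of `c − μ` over the remaining non-trivial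
`n`-th roots of unity `μ`). [folklore] -/
theorem exists_isIntegral_sub_mul_eq_geom_sum {n : ℕ} (hn : 0 < n) {ζ₀ : K} (hζ₀ : IsPrimitiveRoot ζ₀ n)
    {ζ : K} (hζ : ζ ^ n = 1) (hζ1 : ζ ≠ 1) (c : ℤ) :
    ∃ t : K, IsIntegral ℤ t ∧ ((c : K) - ζ) * t = ∑ i ∈ range n, (c : K) ^ i := by
  classical
  have hζmem : ζ ∈ (nthRootsFinset n (1 : K)).erase 1 :=
    Finset.mem_erase.mpr ⟨hζ1, (mem_nthRootsFinset hn (1 : K)).mpr hζ⟩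
  refine ⟨∏ μ ∈ ((nthRootsFinset n (1 : K)).erase 1).erase ζ, ((c : K) - μ), ?_, ?_⟩
  · refine IsIntegral.prod _ fun μ hμ => ?_
    have hμn : μ ^ n = 1 :=
      (mem_nthRootsFinset hn (1 : K)).mp (Finset.mem_of_mem_erase (Finset.mem_of_mem_erase hμ))
    have hci : IsIntegral ℤ (c : K) := by
      simpa using isIntegral_algebraMap (R := ℤ) (A := K) (x := c)
    exact hci.sub (IsIntegral.of_pow hn (by rw [hμn]; exact isIntegral_one))
  · have hpoly := prod_X_sub_C_erase_one_eq_geom_sum hn hζ₀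
    rw [← Finset.mul_prod_erase (((nthRootsFinset n (1 : K)).erase 1)) (fun μ => (X - C μ)) hζmem] at hpoly
    have heval := congrArg (Polynomial.eval (c : K)) hpoly
    rw [eval_mul, eval_sub, eval_X, eval_C, eval_prod, eval_geom_sum] at heval
    simp only [eval_sub, eval_X, eval_C] at heval
    exact heval

/-- If `c ≡ 1 (mod p)` and `p ∤ n` then `p ∤ Σ_{i<n} cⁱ` (the sum is `≡ n (mod p)`). [folklore] -/
theorem not_dvd_geom_sum_of_modEq_one {p : ℕ} [NeZero p] {n : ℕ} (hn : ¬ p ∣ n) {c : ℤ}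
    (hc : c ≡ 1 [ZMOD p]) : ¬ (p : ℤ) ∣ ∑ i ∈ range n, c ^ i := by
  intro h
  have h0 : ((∑ i ∈ range n, c ^ i : ℤ) : ZMod p) = 0 := (ZMod.intCast_zmod_eq_zero_iff_dvd _ p).mpr h
  have hc1 : ((c : ℤ) : ZMod p) = 1 := by
    have := (ZMod.intCast_eq_intCast_iff c 1 p).mpr hc
    simpa using this
  have hsum : ((∑ i ∈ range n, c ^ i : ℤ) : ZMod p) = (n : ZMod p) := by
    push_cast
    simp [hc1]
  rw [hsum] at h0
  exact hn ((ZMod.natCast_eq_zero_iff n p).mp h0)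

/-- ★ **Dividing out the cyclotomic unit `c − ζ`.** In `ℂ`: `ζⁿ = 1`, `ζ ≠ 1`, `p ∤ n`, `c ≡ 1 (mod p)`; if
`(c − ζ)·a` is `p′`-integral then `a` is `p′`-integral. [folklore] -/
theorem exists_not_dvd_isIntegral_of_sub_rootOfUnity_mul {p : ℕ} (hp : p.Prime) {n : ℕ} (hn : 0 < n)
    (hpn : ¬ p ∣ n) {ζ : ℂ} (hζ : ζ ^ n = 1) (hζ1 : ζ ≠ 1) {c : ℤ} (hc : c ≡ 1 [ZMOD p]) {a : ℂ}
    (ha : ∃ s : ℕ, ¬ p ∣ s ∧ IsIntegral ℤ ((s : ℂ) * (((c : ℂ) - ζ) * a))) :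
    ∃ s : ℕ, ¬ p ∣ s ∧ IsIntegral ℤ ((s : ℂ) * a) := by
  haveI : NeZero p := ⟨hp.ne_zero⟩
  obtain ⟨t, ht, htt⟩ :=
    exists_isIntegral_sub_mul_eq_geom_sum hn (Complex.isPrimitiveRoot_exp n hn.ne') hζ hζ1 c
  refine exists_not_dvd_isIntegral_of_mul_of_mul_eq_intCast p hp ha ht
    (k := ∑ i ∈ range n, c ^ i) ?_ (not_dvd_geom_sum_of_modEq_one hpn hc)
  rw [htt]; push_cast; rfl

/-- ★★ **Dividing out Kato's factor `c² − c·ζ = c·(c − ζ)`** (`ζ = χ(c)` a root of unity `≠ 1` of order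
dividing `n`, `p ∤ n`, `c ≡ 1 (mod p)` — so `c` itself is a `p′`-unit): if `(c² − c·ζ)·a` is `p′`-integral
then `a` is `p′`-integral. Two such divisions handle `T_{c,d}(χ) = (c² − cχ(c))(d² − dχ̄(d))` of Kato's
Thm. 6.6 (1) (case `ξ ∈ SL₂(ℤ)`). [folklore] -/
theorem exists_not_dvd_isIntegral_of_katoFactor_mul {p : ℕ} (hp : p.Prime) {n : ℕ} (hn : 0 < n)
    (hpn : ¬ p ∣ n) {ζ : ℂ} (hζ : ζ ^ n = 1) (hζ1 : ζ ≠ 1) {c : ℤ} (hc : c ≡ 1 [ZMOD p]) {a : ℂ}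
    (ha : ∃ s : ℕ, ¬ p ∣ s ∧ IsIntegral ℤ ((s : ℂ) * (((c : ℂ) ^ 2 - (c : ℂ) * ζ) * a))) :
    ∃ s : ℕ, ¬ p ∣ s ∧ IsIntegral ℤ ((s : ℂ) * a) := by
  -- `c² − cζ = c · (c − ζ)`; first divide by `c` (an integer `≡ 1 (mod p)`), then by `c − ζ`
  have hcp : ¬ (p : ℤ) ∣ c := by
    intro h
    have h1 : (p : ℤ) ∣ 1 := by
      have := (Int.ModEq.symm hc).dvd  -- `p ∣ c - 1`? orientation: `a ≡ b [ZMOD n] → n ∣ b - a`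
      -- `hc.symm : 1 ≡ c`, `.dvd : p ∣ c - 1`
      have h2 : (p : ℤ) ∣ c - (c - 1) := dvd_sub h this
      simpa using h2
    exact hp.ne_one (by exact_mod_cast Int.eq_one_of_dvd_one (by positivity) h1)
  have ha' : ∃ s : ℕ, ¬ p ∣ s ∧ IsIntegral ℤ ((s : ℂ) * ((c : ℂ) * (((c : ℂ) - ζ) * a))) := by
    obtain ⟨s, hs, hsa⟩ := ha
    refine ⟨s, hs, ?_⟩
    have : (s : ℂ) * ((c : ℂ) * (((c : ℂ) - ζ) * a)) = (s : ℂ) * (((c : ℂ) ^ 2 - (c : ℂ) * ζ) * a) := by ring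
    rw [this]; exact hsa
  exact exists_not_dvd_isIntegral_of_sub_rootOfUnity_mul hp hn hpn hζ hζ1 hc
    (exists_not_dvd_isIntegral_of_intCast_mul p hp ha' hcp)

end Cyclotomic

end Summit.BirchSwinnertonDyer.BirchSwinnertonDyer.Theorems.PIntegralUnits

end
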